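import Mathlib
import Summits.ResolutionOfSingularities.ResolutionOfSingularities.Theorems.WeightedInvariantLocalWeightedDropNewtonSetChartLaws
import Summits.ResolutionOfSingularities.ResolutionOfSingularities.Theorems.WeightedInvariantLocalWeightedDropWildMonicFlagDefs
import Summits.ResolutionOfSingularities.ResolutionOfSingularities.Theorems.WeightedInvariantLocalWeightedDropWildMonicFlagN0Transport

/-!
# `WeightedInvariant.LocalWeightedDrop`, line `hasse-ridge-face-selection`, S3ρ sub-stub S3ρD `stub_wildMonicSurfaceDescent`:
# CASE D-b — the `n_𝓕 = 1` FLAG and the KANGAROO-DIRECTION point step (both boundary components lost), on point sets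

Crux item stmt-ResolutionOfSingularities-8899 `LocalWeightedDrop` (route `ResolutionOfSingularities/WeightedInvariant`), engine of the
door `HypersurfaceCentreConstruction` stmt-ResolutionOfSingularities-19897.  [OURS · L1 W4.3, chain w43, res-L1-w43-stub-5 = seat
res-D-pv-056, third seat on S3ρ under res-type-083 (case D-b of `L/res-type-083/S3RHO-DESIGN.md` §1(D)); built on stub-7's point-set
vocabulary (`WildMonic.newtonSet / excExp / reduce / dRes`, `…WildMonicFlagDefs`) and lead-1 / type-o7's Newton-set laws
(`MonicDescent.deltaL / psi`, `…NewtonSetChartLaws`).  MODEL: S. Perlega, thesis Wien 2017 / arXiv:2011.14443, Ch. 9 Prop. 9.1.1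
(bullet `n_𝓕 = 1`) and Lemma 9.1.3 (= Hauser–Perlega, Publ. RIMS 60 (2024) Prop. 6, the case «both exceptional components lost»);
nothing here is a statement of H. Hironaka's manuscript, and nothing is asserted about Perlega's text — these are OUR lemmas about OUR
point-set numbers.]

THE SITUATION.  A position `A = (A_j)_{j<d}` of the S3ρ game with boundary `E = V(x₁x₂)` (both axes exceptional) is blown up in the
point and the Refuter answers with a TRANSLATED point `(1 : t)`, `t ≠ 0`, of the exceptional curve: BOTH components of `E` are lost
(their strict transforms miss the new point), the new boundary is `E′ = V(s)` alone.  After the free plane move `x₂ ↦ x₂ + t x₁`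
(`WildMonic.won_monic_substX_iff`) the translated point is the ORIGIN OF THE `x₁`-CHART of the sheared tuple `A^{(t)}`, so on the
`d!`-scaled Newton set `N = newtonSet A^{(t)}` the step is the monomial map `psi L` (`L = d!`), exactly as in stub-7's case D-a — but the
boundary bookkeeping differs: `E′ = {0}` (NOT `excNext E`).  Perlega measures this step with the flag `𝓕 = (V(y) ⊃ V(y, x₂^{(t)}))`,
which has `n_𝓕 = 1` (it is transversal to both lost components), weights `ω = (1, n_𝓕) = (1, 1)`:
`m_{𝓕,x} = ord J₂ = deltaL N`, `d_{𝓕,x} = ord_{(x₂)} in(J₂) =` the least `P₁` over the `δ`-FACE `{P ∈ N : P₀ + P₁ = deltaL N}`.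

CONTENTS (def-free; every number is spelled by `∀`/`∃` over the face):
* `dRes_lost_image_psi_add` — «`d_{𝓕′} = η(J₂) − ord J₂`» (Perlega p0103): `dRes {0} (psi L '' N) + deltaL N = min_{P ∈ N} (P₀ + 2 P₁)`;
* `dRes_lost_image_psi_le` — THE TRANSPORT INEQUALITY «`d_{𝓕′} ≤ ord_{(y)} in(J₂) = d_{𝓕,x}`»: `dRes {0} (psi L '' N) ≤ P₁` for every
  point `P` of the `δ`-face — so `(d_{𝓕′}, n_{𝓕′} = 0, ·) <_lex (d_{𝓕,x}, 1, 0)`: the induced coordinate flag at the new point is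
  dominated by the `n = 1` flag at the old one whenever `d_𝓕 = d_{𝓕,x}` (the small-value conventions are the measure's, not this file's);
* `termSR_shape_of_lost_image_psi` — LEMMA 9.1.3 ON POINT SETS (the convention `d_𝓕 = −1`): if `L ∣ deltaL N`, `deltaL N = L (m + 1)`
  with `m ≥ 1`, and the least face height `b` satisfies `0 < b < L`, then the successor set `psi L '' N` has the SMALL-RESIDUAL SHAPE for
  the letter `0`: every point has `P₀ ≥ L m`, no point is `(L m, 0)`, and some point has `P₀ + P₁ < L (m + 1)`;
* `exists_lt_of_lost_image_psi` — the complementary vacuity: if `deltaL N = L` (i.e. `m = 0`) and some face point has `P₁ < L`, the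
  successor set has a point of total degree `< L`, so it is not the Newton set of a position and the supplier of
  `WildMonic.monic_won_of_descent` never meets it;
* `termSR_data_of_newtonSet` — the COEFFICIENT-LEVEL READING: if the scaled Newton set of a tuple `A′` has the small-residual shape for
  the letter `i`, then `A′` carries the literal TermSR data of `WildMonic.termSR_won` (p-landed, res-type-083):
  `∀ j, ∃ g, g(0) = 0 ∧ A′_j = x_i^{(d−j)m} g` and `∃ j₁ g, A′_{j₁} = x_i^{(d−j₁)m} g ∧ ord g < d − j₁`.
The identification «Newton set of the game's successor tuple at a translated point = `psi d!` of the Newton set of the sheared tuple»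
is stub-7's `…WildMonicNewtonPointStep` (bridge under construction) and is NOT restated here.
AI-written; gate-accepted means sorry-free with standard axioms, not refereed.
-/

set_option linter.dupNamespace false -- mandated namespace of this single-conjunct summit

namespace Summit.ResolutionOfSingularities.ResolutionOfSingularities.Theorems

namespace WildMonic

open MonicDescent MvPowerSeries

variable {N : Set (Fin 2 →₀ ℕ)} {L : ℕ}

/-! ## The `n = 1` flag numbers and the kangaroo-direction transport (point sets) -/

/-- The least face height exists: some point of the `δ`-face of a nonempty set has the least second coordinate among face points
(this is `d_{𝓕,x} = ord_{(x₂)} in(J₂)` for the `n = 1` flag, on the `d!`-scale). -/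
theorem exists_face_min (hN : N.Nonempty) :
    ∃ P ∈ N, P 0 + P 1 = deltaL N ∧ ∀ Q ∈ N, Q 0 + Q 1 = deltaL N → P 1 ≤ Q 1 := by
  classical
  have hF : ((fun P : Fin 2 →₀ ℕ => P 1) '' {P | P ∈ N ∧ P 0 + P 1 = deltaL N}).Nonempty := by
    obtain ⟨P, hP, hPd⟩ := exists_eq_deltaL hN
    exact ⟨P 1, P, ⟨hP, hPd⟩, rfl⟩
  obtain ⟨P, ⟨hP, hPd⟩, hPb⟩ := Nat.sInf_mem hF
  have hPb' : P 1 = sInf ((fun P : Fin 2 →₀ ℕ => P 1) '' {P | P ∈ N ∧ P 0 + P 1 = deltaL N}) := hPb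
  refine ⟨P, hP, hPd, fun Q hQ hQd => ?_⟩
  rw [hPb']
  exact Nat.sInf_le ⟨Q, ⟨hQ, hQd⟩, rfl⟩

/-- The exceptional exponents of the successor for the boundary `E′ = {V(s)}` (both old components lost): `r′ = (deltaL N − L, 0)`. -/
theorem excExp_lost_image_psi (hN : N.Nonempty) :
    excExp {0} (psi L '' N) 0 = deltaL N - L ∧ excExp {0} (psi L '' N) 1 = 0 := by
  constructor
  · rw [excExp_apply_zero, if_pos (Finset.mem_singleton_self 0), alphaL_image_psiC L hN]
  · rw [excExp_apply_one, if_neg (by decide)]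

/-- «`d_{𝓕′} = η(J₂) − ord J₂`» (Perlega Prop. 9.1.1, proof of the `n_𝓕 = 1` bullet): for the boundary `E′ = {V(s)}` the residual
order of the successor point set is the `(1,2)`-weighted order of the source minus its order. -/
theorem dRes_lost_image_psi_add (hN : N.Nonempty) (hL : ∀ P ∈ N, L ≤ P 0 + P 1) :
    dRes {0} (psi L '' N) + deltaL N = sInf ((fun P : Fin 2 →₀ ℕ => P 0 + 2 * P 1) '' N) := by
  have hN' : (psi L '' N).Nonempty := hN.image _
  have hsum := dRes_add_excExp ({0} : Finset (Fin 2)) hN'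
  obtain ⟨hr0, hr1⟩ := excExp_lost_image_psi (L := L) hN
  rw [hr0, hr1, add_zero] at hsum
  have hη := deltaL_image_psiC_add hL hN
  have hδL : L ≤ deltaL N := by
    obtain ⟨P, hP, hPd⟩ := exists_eq_deltaL hN
    rw [← hPd]; exact hL P hP
  omega

/-- THE TRANSPORT INEQUALITY OF CASE D-b (Perlega Prop. 9.1.1, `n_𝓕 = 1`: «`d_{𝓕′} ≤ ord_{(y)} in(J_{2,x}(a))`»): for the boundary
`E′ = {V(s)}` the residual order of the successor is at most the height `P₁` of ANY point of the `δ`-face of the source — in particular at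
most the least face height `d_{𝓕,x}` of the `n = 1` flag. -/
theorem dRes_lost_image_psi_le (hN : N.Nonempty) (hL : ∀ P ∈ N, L ≤ P 0 + P 1)
    {P : Fin 2 →₀ ℕ} (hP : P ∈ N) (hPd : P 0 + P 1 = deltaL N) : dRes {0} (psi L '' N) ≤ P 1 := by
  have h := dRes_lost_image_psi_add hN hL
  have hη : sInf ((fun P : Fin 2 →₀ ℕ => P 0 + 2 * P 1) '' N) ≤ P 0 + 2 * P 1 := Nat.sInf_le ⟨P, hP, rfl⟩
  omega

/-! ## Lemma 9.1.3 on point sets: the convention `d_𝓕 = −1` forces a SMALL-RESIDUAL successor (or no position at all) -/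

/-- LEMMA 9.1.3 ON POINT SETS.  If the order is a multiple of the scale, `deltaL N = L (m + 1)` with `m ≥ 1`, and the least face height
`b = P₁` (of a face point `P` minimal among face points) satisfies `0 < b < L`, then the successor set `psi L '' N` for the boundary
`{V(s)}` has the SMALL-RESIDUAL SHAPE for the letter `0`: (i) every point has first coordinate `≥ L m`; (ii) no point is `(L m, 0)`;
(iii) the image of `P` has total degree `< L (m + 1)`. -/
theorem termSR_shape_of_lost_image_psi {m : ℕ} (hδ : deltaL N = L * (m + 1))
    {P : Fin 2 →₀ ℕ} (hP : P ∈ N) (hPd : P 0 + P 1 = deltaL N) (hPmin : ∀ Q ∈ N, Q 0 + Q 1 = deltaL N → P 1 ≤ Q 1)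
    (hb0 : 0 < P 1) (hbL : P 1 < L) :
    (∀ Q ∈ psi L '' N, L * m ≤ Q 0) ∧ (∀ Q ∈ psi L '' N, Q 0 = L * m → 0 < Q 1) ∧
      ∃ Q ∈ psi L '' N, Q 0 + Q 1 < L * (m + 1) := by
  refine ⟨?_, ?_, ⟨psi L P, ⟨P, hP, rfl⟩, ?_⟩⟩
  · rintro Q ⟨R, hR, rfl⟩
    rw [psi_apply_zero]
    have h := deltaL_le hR
    rw [hδ] at h
    have : L * (m + 1) = L * m + L := by ring
    omega
  · rintro Q ⟨R, hR, rfl⟩ hQ0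
    rw [psi_apply_zero] at hQ0
    rw [psi_apply_one]
    have hRd := deltaL_le hR
    have hL1 : L * (m + 1) = L * m + L := by ring
    -- `R` lies on the face
    have hRface : R 0 + R 1 = deltaL N := by rw [hδ]; omega
    have := hPmin R hR hRface
    omega
  · rw [psi_apply_zero, psi_apply_one, hPd, hδ]
    have hL1 : L * (m + 1) = L * m + L := by ring
    omega

/-- THE VACUOUS CASE `m = 0` of Lemma 9.1.3: if `deltaL N = L` and some face point has height `P₁ < L`, then the successor set has a
point of total degree `< L` (namely the image of that face point, of total degree `P₁`) — so a tuple whose scaled Newton set it is, is NOT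
a position (positions have every scaled total degree `> L = d!`), and the supplier of `WildMonic.monic_won_of_descent` never meets it. -/
theorem exists_lt_of_lost_image_psi (hδ : deltaL N = L) {P : Fin 2 →₀ ℕ} (hP : P ∈ N) (hPd : P 0 + P 1 = deltaL N)
    (hbL : P 1 < L) : ∃ Q ∈ psi L '' N, Q 0 + Q 1 < L := by
  refine ⟨psi L P, ⟨P, hP, rfl⟩, ?_⟩
  rw [psi_apply_zero, psi_apply_one, hPd, hδ]
  omega

/-! ## The coefficient-level reading of the small-residual shape -/

variable {k : Type} [Field k]

/-- Scaled points of the Newton set: the exponent `e` of `A_j` contributes the point `slotWeight d j • e`. -/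
theorem smul_mem_newtonSet {d : ℕ} (A : Fin d → MvPowerSeries (Fin 2) k) (j : Fin d) {e : Fin 2 →₀ ℕ}
    (he : coeff e (A j) ≠ 0) : slotWeight d j • e ∈ newtonSet A :=
  ⟨j, e, he, rfl⟩

/-- THE COEFFICIENT-LEVEL READING (input shape of `WildMonic.termSR_won`, res-type-083): if the `d!`-scaled Newton set of a tuple
`A′ = (A′_j)_{j<d}` has the small-residual shape for the letter `i` with multiplicity `m` — every point has `i`-th coordinate `≥ d!·m`, no
point sits at `d!·m` on the `i`-axis, and some point has total degree `< d!·(m+1)` — then every `A′_j` is `x_i^{(d−j)m} · g_j` with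
`g_j(0) = 0`, and some `g_{j₁}` has order `< d − j₁`. -/
theorem termSR_data_of_newtonSet {d : ℕ} (A : Fin d → MvPowerSeries (Fin 2) k) (i : Fin 2) (m : ℕ)
    (h1 : ∀ Q ∈ newtonSet A, d.factorial * m ≤ Q i)
    (h2 : ∀ Q ∈ newtonSet A, Q i = d.factorial * m → 0 < Q (if i = 0 then 1 else 0))
    (h3 : ∃ Q ∈ newtonSet A, Q 0 + Q 1 < d.factorial * (m + 1)) :
    (∀ j : Fin d, ∃ g : MvPowerSeries (Fin 2) k, constantCoeff g = 0 ∧ A j = X i ^ ((d - (j : ℕ)) * m) * g) ∧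
      ∃ (j₁ : Fin d) (g : MvPowerSeries (Fin 2) k), A j₁ = X i ^ ((d - (j₁ : ℕ)) * m) * g ∧
        g.order < ((d - (j₁ : ℕ) : ℕ) : ℕ∞) := by
  classical
  -- divisibility of every entry by `x_i^{(d-j)m}`
  have hdiv : ∀ j : Fin d, X i ^ ((d - (j : ℕ)) * m) ∣ A j := fun j => by
    refine X_pow_dvd_iff.mpr fun e he => ?_
    by_contra hne
    have hQ := h1 _ (smul_mem_newtonSet A j hne)
    simp only [Finsupp.smul_apply, smul_eq_mul] at hQ
    have hw := slotWeight_mul_sub j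
    have hwpos := slotWeight_pos j
    -- `w_j * e_i ≥ d! m = w_j (d-j) m` ⇒ `e_i ≥ (d-j) m`
    have : slotWeight d j * ((d - (j : ℕ)) * m) ≤ slotWeight d j * e i := by
      calc slotWeight d j * ((d - (j : ℕ)) * m) = d.factorial * m := by rw [← mul_assoc, hw]
        _ ≤ slotWeight d j * e i := hQ
    exact absurd (Nat.le_of_mul_le_mul_left this hwpos) (not_le.mpr he)
  choose g hg using hdiv
  refine ⟨fun j => ⟨g j, ?_, hg j⟩, ?_⟩
  · -- `g_j(0) = 0`: otherwise the point `(d! m, 0)` (for `i = 0`; `(0, d! m)` for `i = 1`) would lie in the Newton set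
    by_contra hg0
    have hcoeff : coeff (Finsupp.single i ((d - (j : ℕ)) * m)) (A j) ≠ 0 := by
      rw [hg j, X_pow_eq, coeff_monomial_mul, if_pos le_rfl, tsub_self, one_mul, coeff_zero_eq_constantCoeff]
      exact hg0
    have hmem := smul_mem_newtonSet A j hcoeff
    have hQi : (slotWeight d j • Finsupp.single i ((d - (j : ℕ)) * m)) i = d.factorial * m := by
      simp only [Finsupp.smul_apply, Finsupp.single_eq_same, smul_eq_mul]
      rw [← mul_assoc, slotWeight_mul_sub]
    have h := h2 _ hmem hQi
    have hother : (if i = 0 then (1 : Fin 2) else 0) ≠ i := by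
      fin_cases i <;> simp
    simp only [Finsupp.smul_apply, smul_eq_mul, Finsupp.single_eq_of_ne hother, mul_zero, lt_self_iff_false] at h
  · obtain ⟨Q, ⟨j₁, e, he, rfl⟩, hlt⟩ := h3
    refine ⟨j₁, g j₁, hg j₁, ?_⟩
    -- the exponent `e` of `A_{j₁}` is `(d - j₁) m • δ_i + e'` with `e'` an exponent of `g_{j₁}` of small degree
    have hei : (d - (j₁ : ℕ)) * m ≤ e i := by
      have hQ := h1 _ (smul_mem_newtonSet A j₁ he)
      simp only [Finsupp.smul_apply, smul_eq_mul] at hQ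
      have hw := slotWeight_mul_sub j₁
      have : slotWeight d j₁ * ((d - (j₁ : ℕ)) * m) ≤ slotWeight d j₁ * e i := by
        calc slotWeight d j₁ * ((d - (j₁ : ℕ)) * m) = d.factorial * m := by rw [← mul_assoc, hw]
          _ ≤ slotWeight d j₁ * e i := hQ
      exact Nat.le_of_mul_le_mul_left this (slotWeight_pos j₁)
    set e' : Fin 2 →₀ ℕ := e - Finsupp.single i ((d - (j₁ : ℕ)) * m) with he'
    have hsplit : Finsupp.single i ((d - (j₁ : ℕ)) * m) + e' = e := by
      rw [he', add_tsub_cancel_of_le]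
      refine Finsupp.le_def.mpr fun l => ?_
      by_cases hl : l = i
      · subst hl; rw [Finsupp.single_eq_same]; exact hei
      · rw [Finsupp.single_eq_of_ne hl]; exact Nat.zero_le _
    have hcoeff' : coeff e' (g j₁) ≠ 0 := by
      have h := he
      rw [hg j₁, X_pow_eq, ← hsplit, coeff_monomial_mul, if_pos le_self_add, add_tsub_cancel_left, one_mul] at h
      exact h
    refine lt_of_le_of_lt (order_le hcoeff') ?_
    -- degree count: `w • e` has total `< d! (m+1)` and `w (d - j₁) = d!`
    have hw := slotWeight_mul_sub j₁
    have hwpos := slotWeight_pos j₁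
    simp only [Finsupp.smul_apply, smul_eq_mul] at hlt
    have hdeg : e'.degree = e' 0 + e' 1 := by
      rw [Finsupp.degree_eq_sum, Fin.sum_univ_two]
    have he'0 : e' 0 + (Finsupp.single i ((d - (j₁ : ℕ)) * m)) 0 = e 0 := by
      have := congrArg (fun f => f 0) hsplit; simp only [Finsupp.add_apply] at this; omega
    have he'1 : e' 1 + (Finsupp.single i ((d - (j₁ : ℕ)) * m)) 1 = e 1 := by
      have := congrArg (fun f => f 1) hsplit; simp only [Finsupp.add_apply] at this; omega
    have hsingle : (Finsupp.single i ((d - (j₁ : ℕ)) * m)) 0 + (Finsupp.single i ((d - (j₁ : ℕ)) * m)) 1 =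
        (d - (j₁ : ℕ)) * m := by
      fin_cases i <;> simp
    -- `w * (e'₀ + e'₁) + d! m = w * (e₀ + e₁) < d! (m + 1) = d! m + w (d - j₁)`
    have hlt' : slotWeight d j₁ * (e' 0 + e' 1) < slotWeight d j₁ * (d - (j₁ : ℕ)) := by
      have h1 : slotWeight d j₁ * (e' 0 + e' 1) + d.factorial * m = slotWeight d j₁ * (e 0 + e 1) := by
        rw [← hw]
        have : e 0 + e 1 = (e' 0 + e' 1) + (d - (j₁ : ℕ)) * m := by omega
        rw [this]; ring
      have h2 : d.factorial * (m + 1) = d.factorial * m + slotWeight d j₁ * (d - (j₁ : ℕ)) := by rw [hw]; ring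
      have h3 : slotWeight d j₁ * (e 0 + e 1) < d.factorial * (m + 1) := by
        have := hlt; rw [Nat.mul_add] at this ⊢; omega
      omega
    have := Nat.lt_of_mul_lt_mul_left hlt'
    rw [hdeg]
    exact_mod_cast this

end WildMonic

end Summit.ResolutionOfSingularities.ResolutionOfSingularities.Theorems
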